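import Literature.Geometry.Kaehler.CyclotomicCMTypesDegreeEightAllPowersHodgeConjecture
import HarnessLib

/-!
# EVERY abelian variety with complex multiplication by a cyclotomic field of degree `≤ 8` (any CM type) has `B•(Aⁿ) ⊗ ℂ = D•(Aⁿ) ⊗ ℂ`
# and satisfies the Hodge conjecture with all its powers

Layer `Literature/Geometry/Kaehler`, namespace `Literature.Geometry.Kaehler.ComplexTorus`; lane `lit-hodgefound` (Track 2 foundations
library), prover seat `lit-hodgefound-p10`, generation 33, row «A2-26(hi)» (self-proposed 2026-08-28).  Theorems only; no `def`, no instance,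
no named fact (net Literature debt 0).  The variety-side twin of `ComplexTorusCyclotomicCharpolyHodgeClassesDegreeLeEight` (torus side).

`K = ℚ(ζ_d)`, `d > 2`, `φ(d) ≤ 8`, `Φ` ANY CM type of `K`, `A ⊨ (K; Φ)`.  `φ(d) = 8`: the sibling `CyclotomicCMTypesDegreeEightAllPowersHodgeConjecture`.
`φ(d) ≤ 6`: a PRIMITIVE `Φ` is nondegenerate (Ribet–Lenstra–Dodson, tree `isNondegenerate_of_isPrimitive_of_finrank_le_six`), so White–Hazama
(`IsNondegenerate.hodgeClassSpan_pow_eq_divisorClassesSpan`); an IMPRIMITIVE `Φ` is induced from its primitive sub-pair `(K₁, Φ₁)` with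
`[K : K₁] = |W(S_Φ)| ≥ 2` (**`two_le_finrank_of_inducedCMType_eq_of_not_isPrimitive`**, Koblitz–Rohrlich on residues: `W ∋ 1` and some
`t ≠ 1`), so `[K₁ : ℚ] ≤ 3` and `Φ₁` is nondegenerate; Hazama's criterion (`IsNondegenerate.hodgeClassSpan_pow_eq_divisorClassesSpan_inducedCMType`).

* **`two_le_finrank_of_inducedCMType_eq_of_not_isPrimitive`** (any level `d`).
* **`hodgeClassSpan_pow_eq_divisorClassesSpan_of_totient_le_eight`**, **`hodgeConjectureFor_pow_of_totient_le_eight`** (the Hodge conjecture for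
  EVERY power of EVERY abelian variety with complex multiplication by a cyclotomic field of degree `≤ 8`, any CM type),
  `hodgeConjectureFor_of_totient_le_eight` (`A` itself: `Bᵐ(A) = Dᵐ(A)`, `HodgeConjectureFor A.dim A.X`).

## References

* [Gordon1999HodgeAVSurvey] B. B. Gordon, *A survey of the Hodge conjecture for abelian varieties* (1999), Thm. 6.4, §9.3.
* [Hazama2003CyclicCM] F. Hazama, J. Math. Sci. Univ. Tokyo 10 (2003), p. 582.
* [KoblitzRohrlich1978] N. Koblitz, D. Rohrlich, Canad. J. Math. 30 (1978), §1 p. 1184.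
* [Streng2010] M. Streng, PhD thesis, Leiden (2010), Ch. I Lemma 3.5.
* [MoonenZarhin1999LowDim] B. Moonen, Yu. Zarhin, Math. Ann. 315 (1999), Thm. 0.1 (the torus-side statement in dimension `≤ 5`).
-/

noncomputable section

open scoped Classical nonZeroDivisors NumberField
open NumberField Module CategoryTheory CategoryTheory.Limits

namespace Literature.Geometry.Kaehler

namespace ComplexTorus

-- `open scoped`: the tree's action of `Aut(ℂ)` on `Hom(K, ℂ)` by composition (`ringEquivCompAction`) is a scoped instance
open scoped Literature.NumberTheory.ComplexMultiplication
open Literature.AlgebraicGeometry.Motives (CMType AbelianVariety)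
open Literature.AlgebraicGeometry.HodgeTheory (HodgeConjectureFor complexBetti IsRationalClass IsOfHodgeType algebraicClasses)
open Literature.AlgebraicGeometry.VanGeemen1994 (hodgeClassSpan)
open Literature.Barriers.HodgeConjecture (divisorClassesSpan)
open Literature.NumberTheory.ComplexMultiplication (IsPrimitive inducedCMType exists_primitive_inducedCMType_eq_of_isCMField)
open Literature.AlgebraicGeometry.Pohlmann1968 (IsNondegenerate isNondegenerate_of_isPrimitive_of_finrank_le_six)
open Literature.AlgebraicGeometry.ComplexMultiplication (IsCMTypeRealisation isPrimitive_ringEquiv_complex_iff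
  finrank_eq_card_filter_of_primitive one_mem_stabilizerResidues)
open Literature.AlgebraicGeometry.ComplexMultiplication.CyclotomicCMTypeResidueSets (unitResidues residueSet HasTrivialStabilizer
  isPrimitive_iff_hasTrivialStabilizer)

variable {d : ℕ} {K : Type} [Field K] [NumberField K]
  {A : AbelianVariety ℂ} {ι : 𝓞 K →+* End A} {θ : K →+* Module.End ℂ (complexBetti A.X 1)}

/-- **`[K : K₁] ≥ 2` FOR THE PRIMITIVE SUB-PAIR OF AN IMPRIMITIVE CM TYPE OF `ℚ(ζ_d)`** (any `d`): `[K : K₁] = |W(S_Φ)|` (Koblitz–Rohrlich)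
and `W ∋ 1, t` with `t ≠ 1` since `Φ` is not primitive. [cite: KoblitzRohrlich1978, §1 p. 1184] [cite: Streng2010, Ch. I Lemma 3.5] -/
theorem two_le_finrank_of_inducedCMType_eq_of_not_isPrimitive [NeZero d] (hK : IsCyclotomicExtension {d} ℚ K) {Φ : CMType K}
    {K₁ : IntermediateField ℚ K} {Φ₁ : CMType K₁} (h₁ : inducedCMType (algebraMap K₁ K) Φ₁ = Φ)
    (hp₁ : ∀ s t : K₁ →+* ℂ,
      (∀ τ : ℂ ≃+* ℂ, (τ : ℂ →+* ℂ).comp s ∈ Φ₁.1 ↔ (τ : ℂ →+* ℂ).comp t ∈ Φ₁.1) → s = t)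
    (φ₀ : K →+* ℂ) (hΦ : ¬ IsPrimitive (ℂ ≃+* ℂ) Φ.1 φ₀) : 2 ≤ Module.finrank K₁ K := by
  haveI := hK
  rw [finrank_eq_card_filter_of_primitive (N := d) Φ Φ₁ h₁ hp₁]
  have hnt : ¬ HasTrivialStabilizer d (residueSet d Φ) := fun h ↦ hΦ ((isPrimitive_iff_hasTrivialStabilizer d Φ φ₀).2 h)
  simp only [HasTrivialStabilizer, not_forall] at hnt
  obtain ⟨t, ht, hstab, ht1⟩ := hnt
  have h1mem := one_mem_stabilizerResidues (N := d) Φ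
  have htmem : t ∈ (unitResidues d).filter
      (fun t => ∀ c ∈ unitResidues d, (c * t ∈ residueSet d Φ ↔ c ∈ residueSet d Φ)) :=
    Finset.mem_filter.2 ⟨ht, hstab⟩
  calc 2 = ({1, t} : Finset (ZMod d)).card := by rw [Finset.card_pair (Ne.symm ht1)]
    _ ≤ _ := Finset.card_le_card (by
        intro x hx
        simp only [Finset.mem_insert, Finset.mem_singleton] at hx
        rcases hx with rfl | rfl
        exacts [h1mem, htmem])

/-- `Bᵐ ⊗ ℂ = Dᵐ ⊗ ℂ` for all `m` on an abelian variety `B` gives the Hodge conjecture for `B` (Lefschetz `(1,1)`, cup products).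
[cite: Gordon1999HodgeAVSurvey, §9.3] -/
private theorem hodgeConjectureFor_of_forall_hodgeClassSpan_eq₄₄ (B : AbelianVariety ℂ)
    (h : ∀ m : ℕ, hodgeClassSpan B.dim B.X m = divisorClassesSpan B.X B.dim m) : HodgeConjectureFor B.dim B.X :=
  ⟨Literature.AlgebraicGeometry.HodgeTheory.nonempty_hodgeModel_holds
      (Literature.AlgebraicGeometry.Motives.AbelianVariety.isSmoothProjective_holds (A := B)),
    fun m _ hc hmm ↦ Literature.AlgebraicGeometry.HodgeTheory.AbelianVariety.divisorClassesSpan_le_algebraicClasses B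
      (fun b hb hb' ↦ Literature.AlgebraicGeometry.HodgeTheory.lefschetzOneOne_rational_holds
        (Literature.AlgebraicGeometry.Motives.AbelianVariety.isSmoothProjective_holds (A := B)) b hb hb') m
      ((h m) ▸ Submodule.subset_span ⟨hc, hmm⟩)⟩

/-- **`Bᵐ(Aⁿ) ⊗ ℂ = Dᵐ(Aⁿ) ⊗ ℂ` FOR ALL `n, m`, FOR EVERY CM TYPE OF EVERY CYCLOTOMIC FIELD `ℚ(ζ_d)` WITH `d > 2`, `φ(d) ≤ 8`, AND EVERY
REALISATION.** [cite: Gordon1999HodgeAVSurvey, Thm. 6.4 and §9.3] [cite: Hazama2003CyclicCM, p. 582] [cite: KoblitzRohrlich1978, §1 p. 1184]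
[cite: Streng2010, Ch. I Lemma 3.5] -/
theorem hodgeClassSpan_pow_eq_divisorClassesSpan_of_totient_le_eight (hK : IsCyclotomicExtension {d} ℚ K) (hd : 2 < d)
    (h8 : Nat.totient d ≤ 8) (Φ : CMType K) (hA : IsCMTypeRealisation Φ A ι θ) (n m : ℕ) :
    hodgeClassSpan (⨁ fun _ : Fin n => A).dim (⨁ fun _ : Fin n => A).X m =
      divisorClassesSpan (⨁ fun _ : Fin n => A).X (⨁ fun _ : Fin n => A).dim m := by
  by_cases h8' : Nat.totient d = 8
  · exact hodgeClassSpan_pow_eq_divisorClassesSpan_of_totient_eq_eight hK h8' Φ hA n m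
  have h6 : Nat.totient d ≤ 6 := by
    obtain ⟨r, hr⟩ := Nat.totient_even hd
    omega
  haveI : NeZero d := ⟨by omega⟩
  haveI : IsCMField K := IsCyclotomicExtension.Rat.isCMField K (S := ({d} : Set ℕ)) ⟨d, rfl, hd⟩
  have hK6 : Module.finrank ℚ K ≤ 6 := by rw [IsCyclotomicExtension.Rat.finrank d K]; exact h6
  obtain ⟨φ₀⟩ : Nonempty (K →+* ℂ) := inferInstance
  by_cases hΦ : IsPrimitive (ℂ ≃+* ℂ) Φ.1 φ₀
  · exact (isNondegenerate_of_isPrimitive_of_finrank_le_six Φ hK6 φ₀ hΦ).hodgeClassSpan_pow_eq_divisorClassesSpan hA n m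
  obtain ⟨K₁, Φ₁, hCM, h₁, hp₁, -⟩ := exists_primitive_inducedCMType_eq_of_isCMField Φ
  haveI := hCM
  have h2 := two_le_finrank_of_inducedCMType_eq_of_not_isPrimitive hK h₁ hp₁ φ₀ hΦ
  have hmul : Module.finrank ℚ K₁ * Module.finrank K₁ K = Module.finrank ℚ K := Module.finrank_mul_finrank ℚ K₁ K
  have hK₁ : Module.finrank ℚ K₁ ≤ 6 := by
    have h : Module.finrank ℚ K₁ * 2 ≤ Module.finrank ℚ K := hmul ▸ Nat.mul_le_mul_left _ h2
    omega
  obtain ⟨s₀⟩ : Nonempty (K₁ →+* ℂ) := inferInstance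
  have hp : IsPrimitive (ℂ ≃+* ℂ) Φ₁.1 s₀ := (isPrimitive_ringEquiv_complex_iff Φ₁ s₀).2 hp₁
  exact (isNondegenerate_of_isPrimitive_of_finrank_le_six Φ₁ hK₁ s₀ hp).hodgeClassSpan_pow_eq_divisorClassesSpan_inducedCMType h₁ hA n m

/-- **THE HODGE CONJECTURE FOR EVERY POWER OF EVERY ABELIAN VARIETY WITH COMPLEX MULTIPLICATION BY A CYCLOTOMIC FIELD OF DEGREE `≤ 8`**
(any CM type; `ℚ(ζ_d)`, `d ∈ {3,4,5,6,7,8,9,10,12,14,15,16,18,20,24,30}`), UNCONDITIONALLY. [cite: Gordon1999HodgeAVSurvey, Thm. 6.4 and §9.3]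
[cite: Hazama2003CyclicCM, p. 582] -/
theorem hodgeConjectureFor_pow_of_totient_le_eight (hK : IsCyclotomicExtension {d} ℚ K) (hd : 2 < d) (h8 : Nat.totient d ≤ 8)
    (Φ : CMType K) (hA : IsCMTypeRealisation Φ A ι θ) (n : ℕ) :
    HodgeConjectureFor (⨁ fun _ : Fin n => A).dim (⨁ fun _ : Fin n => A).X :=
  hodgeConjectureFor_of_forall_hodgeClassSpan_eq₄₄ _
    (fun m ↦ hodgeClassSpan_pow_eq_divisorClassesSpan_of_totient_le_eight hK hd h8 Φ hA n m)

/-- **`A` itself**: `dim A = φ(d)/2`, `Bᵐ(A) ⊗ ℂ = Dᵐ(A) ⊗ ℂ` for all `m`, and the Hodge conjecture for `A` (Hazama's intrinsic form for abelian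
CM fields). [cite: Gordon1999HodgeAVSurvey, Thm. 6.4 and §9.3] [cite: Hazama2003CyclicCM, p. 582] -/
theorem hodgeConjectureFor_of_totient_le_eight (hK : IsCyclotomicExtension {d} ℚ K) (hd : 2 < d) (h8 : Nat.totient d ≤ 8) (Φ : CMType K)
    (hA : IsCMTypeRealisation Φ A ι θ) :
    A.dim = Nat.totient d / 2 ∧ (∀ m : ℕ, hodgeClassSpan A.dim A.X m = divisorClassesSpan A.X A.dim m) ∧
      HodgeConjectureFor A.dim A.X := by
  haveI : NeZero d := ⟨by omega⟩
  haveI : IsCMField K := IsCyclotomicExtension.Rat.isCMField K (S := ({d} : Set ℕ)) ⟨d, rfl, hd⟩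
  haveI : IsAbelianGalois ℚ K := IsCyclotomicExtension.isAbelianGalois {d} ℚ K
  have hdim : A.dim = Module.finrank ℚ K / 2 := Literature.AlgebraicGeometry.Motives.schemeDim_eq_holds hA.1
  have hall : ∀ m : ℕ, hodgeClassSpan A.dim A.X m = divisorClassesSpan A.X A.dim m := by
    rw [hdim]
    exact (Literature.AlgebraicGeometry.Pohlmann1968.forall_pow_hodgeClassSpan_eq_iff_forall_hodgeClassSpan_eq hA).1
      (fun n m ↦ hodgeClassSpan_pow_eq_divisorClassesSpan_of_totient_le_eight hK hd h8 Φ hA n m)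
  refine ⟨?_, hall, hodgeConjectureFor_of_forall_hodgeClassSpan_eq₄₄ A hall⟩
  rw [hdim, IsCyclotomicExtension.Rat.finrank d K]

end ComplexTorus

end Literature.Geometry.Kaehler

end
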